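import Summits.CriticalPhenomena.PercolationContinuityZ3.Theorems.PercNearOneGluingNoHeavyLowerTailAntitheticPieces
import HarnessLib

/-!
# `NoHeavyLowerTail` (stmt-CriticalPhenomena-4575) — antithetic cluster pairs: the ANTISYMMETRIC–MONOTONE piece lemma
# and the CLASS-EXACT cover principle (prim-hp-2 gen 34, MEMO-gen34 §1–§2)

Support file (`--supports stmt-CriticalPhenomena-4575`, hull-port prover `prim-hp-2`, gen 34).  No definitions of record, no named
facts, no sorries; standard axioms.

Setting: as in the gen-31/32 files (`…AntitheticHarris`, `…AntitheticPieces`): colourings of a finite edge set, RED/BLUE clusters of a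
source, and sums `Σ_{ω ∈ D} Ψ(ω)` of functionals of the cluster pair over a constraint set `D`.  Two abstract facts used by the
gen-34 re-proof of THEOREM F (own cubes + class-level accounting, MEMO-gen34 §2):

* `Antithetic.piece_am` — the piece lemma in ANTISYMMETRIC–MONOTONE form: if `Φ : Set β → α` is antitone and `a, b : α → α → ℝ` are
  antisymmetric (`a x y = − a y x`), increasing in the first and decreasing in the second argument, then
  `0 ≤ Σ_{S ⊆ β} a(Φ S, Φ Sᶜ) · b(Φ S, Φ Sᶜ)`.  The gen-32 lemma `piece_abstract` is the case `a x y = F x − F y`; the new form also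
  covers e.g. `a x y = sign (F x − F y)` ("sign-concordance", MEMO-gen34 §3).
* `Antithetic.sum_nonneg_of_classSubexact` — the CLASS-EXACT COVER PRINCIPLE: let `key : κ → γ` send a configuration to its
  cluster-pair class, let the functional be a class function `ψ ∘ key`, and let a weighted family of "pieces" `P i` (weights `m i ≥ 0`,
  each with `0 ≤ Σ_{P i} ψ ∘ key`) cover every class `c` with total weight `= #(D ∩ key⁻¹ c)` when `c` is non-nested and
  `≤ #(D ∩ key⁻¹ c)` when `c` is nested (where `ψ c ≥ 0`).  Then `0 ≤ Σ_{ω ∈ D} ψ (key ω)`.  Exactness is required per CLASS, not per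
  configuration, and nested classes may be under-covered — this is what lets the canonical OWN-CUBE family prove Theorem F
  (MEMO-gen34 §2) and what makes such covers compose over the components of `G − s`.
[cite: VandenbergHaggstromKahn2005, §1 p. 6 ("Harris' inequality")]
-/

noncomputable section

namespace Summit.CriticalPhenomena.PercolationContinuityZ3.Theorems

open scoped Classical
open Finset

namespace Antithetic

section AM

variable {β : Type*} [Fintype β] {α : Type*} [Preorder α]

/-- **Piece lemma, antisymmetric–monotone form.**  If `Φ : Set β → α` is antitone and `a, b : α → α → ℝ` are antisymmetric,
increasing in the first argument and decreasing in the second, then `0 ≤ Σ_{S : Set β} a (Φ S) (Φ Sᶜ) · b (Φ S) (Φ Sᶜ)`.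
Proof: `u S := a (Φ Sᶜ) (Φ S)` and `v S := b (Φ Sᶜ) (Φ S)` are increasing in `S` with zero sum (the involution `S ↦ Sᶜ` and
antisymmetry), so the centred Harris inequality gives `0 ≤ Σ u v`, and `u S · v S` is the summand.  The gen-32 lemma
`piece_abstract` is the case `a x y = F x − F y`, `b x y = G x − G y`. [folklore] -/
theorem piece_am (Φ : Set β → α) (hΦ : Antitone Φ) {a b : α → α → ℝ}
    (ha_anti : ∀ x y, a x y = -a y x) (hb_anti : ∀ x y, b x y = -b y x)
    (ha₁ : ∀ y, Monotone fun x => a x y) (ha₂ : ∀ x, Antitone fun y => a x y)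
    (hb₁ : ∀ y, Monotone fun x => b x y) (hb₂ : ∀ x, Antitone fun y => b x y) :
    0 ≤ ∑ S : Set β, a (Φ S) (Φ Sᶜ) * b (Φ S) (Φ Sᶜ) := by
  have hu : Monotone fun S : Set β => a (Φ Sᶜ) (Φ S) := fun S S' h =>
    (ha₁ (Φ S) (hΦ (Set.compl_subset_compl.2 h))).trans (ha₂ (Φ S'ᶜ) (hΦ h))
  have hv : Monotone fun S : Set β => b (Φ Sᶜ) (Φ S) := fun S S' h =>
    (hb₁ (Φ S) (hΦ (Set.compl_subset_compl.2 h))).trans (hb₂ (Φ S'ᶜ) (hΦ h))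
  have hsum : ∀ c : α → α → ℝ, (∀ x y, c x y = -c y x) → ∑ S : Set β, c (Φ Sᶜ) (Φ S) = 0 := by
    intro c hc
    have h1 : ∑ S : Set β, c (Φ Sᶜ) (Φ S) = ∑ S : Set β, c (Φ S) (Φ Sᶜ) :=
      Fintype.sum_equiv (Function.Involutive.toPerm (compl : Set β → Set β) compl_involutive)
        (fun S => c (Φ Sᶜ) (Φ S)) (fun S => c (Φ S) (Φ Sᶜ)) (fun S => by simp)
    have h2 : ∑ S : Set β, c (Φ Sᶜ) (Φ S) = -∑ S : Set β, c (Φ S) (Φ Sᶜ) := by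
      rw [← Finset.sum_neg_distrib]
      exact Finset.sum_congr rfl fun S _ => hc _ _
    linarith
  have h := harris_uniform_centred hu hv (hsum a ha_anti) (hsum b hb_anti)
  refine h.trans_eq (Finset.sum_congr rfl fun S _ => ?_)
  rw [ha_anti (Φ Sᶜ) (Φ S), hb_anti (Φ Sᶜ) (Φ S)]
  ring

end AM

section ClassCover

variable {κ γ ι : Type*} [Fintype γ] [Fintype ι]

/-- Summing a class function over a finite set of configurations, fibrewise: `Σ_{ω ∈ D} ψ (key ω) = Σ_c #(D ∩ key⁻¹ c) · ψ c`.
[folklore] -/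
theorem sum_comp_key_eq (D : Finset κ) (key : κ → γ) (ψ : γ → ℝ) :
    ∑ ω ∈ D, ψ (key ω) = ∑ c : γ, ((D.filter fun ω => key ω = c).card : ℝ) * ψ c := by
  rw [← Finset.sum_fiberwise D key fun ω => ψ (key ω)]
  refine Finset.sum_congr rfl fun c _ => ?_
  rw [Finset.sum_congr rfl fun ω hω => by rw [(Finset.mem_filter.1 hω).2], Finset.sum_const, nsmul_eq_mul]

/-- **The class-exact cover principle** (MEMO-gen34 §1).  Configurations `κ`, classes `key : κ → γ` (the cluster pair), a class
functional `ψ`, a constraint set `D`, and a weighted finite family of pieces `P i ⊆ D`-or-not with weights `m i ≥ 0` and nonnegative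
piece sums `0 ≤ Σ_{P i} ψ ∘ key`.  If every NON-NESTED class is covered with total weight exactly `#(D ∩ class)` and every NESTED
class (`ψ ≥ 0` there) with total weight at most `#(D ∩ class)`, then `0 ≤ Σ_{ω ∈ D} ψ (key ω)`.  (Exactness per class, not per
configuration; nested classes may be under-covered and are "padded" implicitly.) [folklore] -/
theorem sum_nonneg_of_classSubexact (D : Finset κ) (key : κ → γ) (ψ : γ → ℝ) (nested : γ → Prop)
    (P : ι → Finset κ) (m : ι → ℝ) (hm : ∀ i, 0 ≤ m i)
    (hpiece : ∀ i, 0 ≤ ∑ ω ∈ P i, ψ (key ω))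
    (hψ : ∀ c, nested c → 0 ≤ ψ c)
    (hexact : ∀ c, ¬ nested c →
      ∑ i, m i * (((P i).filter fun ω => key ω = c).card : ℝ) = ((D.filter fun ω => key ω = c).card : ℝ))
    (hsub : ∀ c, nested c →
      ∑ i, m i * (((P i).filter fun ω => key ω = c).card : ℝ) ≤ ((D.filter fun ω => key ω = c).card : ℝ)) :
    0 ≤ ∑ ω ∈ D, ψ (key ω) := by
  -- the weighted sum of the piece sums is nonnegative
  have h0 : 0 ≤ ∑ i, m i * ∑ ω ∈ P i, ψ (key ω) :=
    Finset.sum_nonneg fun i _ => mul_nonneg (hm i) (hpiece i)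
  -- rewrite it classwise
  have h1 : ∑ i, m i * ∑ ω ∈ P i, ψ (key ω) =
      ∑ c : γ, (∑ i, m i * (((P i).filter fun ω => key ω = c).card : ℝ)) * ψ c := by
    simp_rw [sum_comp_key_eq (P _) key ψ, Finset.mul_sum, Finset.sum_mul]
    rw [Finset.sum_comm]
    refine Finset.sum_congr rfl fun c _ => Finset.sum_congr rfl fun i _ => ?_
    ring
  -- compare classwise with the sum over `D`
  rw [sum_comp_key_eq D key ψ]
  rw [h1] at h0
  refine h0.trans (Finset.sum_le_sum fun c _ => ?_)
  by_cases hc : nested c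
  · exact mul_le_mul_of_nonneg_right (hsub c hc) (hψ c hc)
  · rw [hexact c hc]

/-- **Nested cluster pairs.**  For the cluster-pair functional `ψ (A, B) = (F A − F B)(G A − G B)` with `F, G` monotone, a class
`(A, B)` with `B ⊆ A` or `A ⊆ B` has `ψ ≥ 0` — the hypothesis `hψ` of `sum_nonneg_of_classSubexact` for the antithetic sums
(restates `delta_nonneg_of_nested` at the level of classes). [folklore] -/
theorem delta_class_nonneg {V : Type*} {F G : Set (Sym2 V) → ℝ} (hF : Monotone F) (hG : Monotone G)
    (c : Set (Sym2 V) × Set (Sym2 V)) (h : c.2 ⊆ c.1 ∨ c.1 ⊆ c.2) :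
    0 ≤ (F c.1 - F c.2) * (G c.1 - G c.2) :=
  delta_nonneg_of_nested h hF hG

end ClassCover

end Antithetic


namespace Antithetic

section AMClusters

open Literature.Probability.Percolation

variable {V : Type*}

/-- **The piece lemma for red/blue clusters, antisymmetric–monotone form** (MEMO-gen34 §5).  Let `T : Set β → Set (Sym2 V)` be a
family of colourings with (i) the red cluster `C_s(T S ∩ E)` antitone in `S` and (ii) the blue cluster of `T S` equal to the red
cluster of `T Sᶜ` (conditions of the gen-32 piece lemma `piece_sum_nonneg`), and let `a, b` be functions of a PAIR of edge sets that
are antisymmetric, increasing in the first and decreasing in the second argument.  Then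
`0 ≤ Σ_S a(red S, blue S) · b(red S, blue S)`.  With `a (A, B) = sign (f A − f B)` this is the "sign-concordance" of the two clusters on
a piece; every class-exact cover transports it to the whole constraint set (`sum_nonneg_of_classSubexact`). [folklore] -/
theorem piece_sum_nonneg_am {β : Type*} [Fintype β] (E : Set (Sym2 V)) (s : V) (T : Set β → Set (Sym2 V))
    (hanti : Antitone fun S => openEdgeCluster (T S ∩ E) s)
    (hblue : ∀ S, openEdgeCluster ((T S)ᶜ ∩ E) s = openEdgeCluster (T Sᶜ ∩ E) s)
    {a b : Set (Sym2 V) → Set (Sym2 V) → ℝ}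
    (ha_anti : ∀ x y, a x y = -a y x) (hb_anti : ∀ x y, b x y = -b y x)
    (ha₁ : ∀ y, Monotone fun x => a x y) (ha₂ : ∀ x, Antitone fun y => a x y)
    (hb₁ : ∀ y, Monotone fun x => b x y) (hb₂ : ∀ x, Antitone fun y => b x y) :
    0 ≤ ∑ S : Set β, a (openEdgeCluster (T S ∩ E) s) (openEdgeCluster ((T S)ᶜ ∩ E) s) *
      b (openEdgeCluster (T S ∩ E) s) (openEdgeCluster ((T S)ᶜ ∩ E) s) := by
  have h := piece_am (fun S => openEdgeCluster (T S ∩ E) s) hanti ha_anti hb_anti ha₁ ha₂ hb₁ hb₂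
  refine h.trans_eq (Finset.sum_congr rfl fun S _ => ?_)
  simp only [hblue S]

end AMClusters

end Antithetic

namespace Antithetic
section ProductCover
variable {κ₁ κ₂ γ₁ γ₂ ι₁ ι₂ : Type*} [Fintype ι₁] [Fintype ι₂]

/-- Fibres of a product key over a product set are products of fibres. [folklore] -/
theorem filter_product_key (A : Finset κ₁) (B : Finset κ₂) (key₁ : κ₁ → γ₁) (key₂ : κ₂ → γ₂) (c₁ : γ₁) (c₂ : γ₂) :
    ((A ×ˢ B).filter fun ω => (key₁ ω.1, key₂ ω.2) = (c₁, c₂)) =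
      (A.filter fun a => key₁ a = c₁) ×ˢ (B.filter fun b => key₂ b = c₂) := by
  ext ⟨a, b⟩
  simp only [Finset.mem_filter, Finset.mem_product, Prod.mk.injEq]
  tauto

/-- **Class-exact families compose over products** (MEMO-gen34 §1c): if the weighted families `(P₁ i, m₁ i)` and `(P₂ j, m₂ j)` cover
every class of `D₁` resp. `D₂` with total weight equal to the class size, then the product family `(P₁ i ×ˢ P₂ j, m₁ i · m₂ j)` covers every
class of `D₁ ×ˢ D₂` (classes for the product key) with total weight equal to its size.  This is the step "petal by petal" in the own-cube proof of
Theorem F. [folklore] -/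
theorem classExact_product (D₁ : Finset κ₁) (D₂ : Finset κ₂) (key₁ : κ₁ → γ₁) (key₂ : κ₂ → γ₂)
    (P₁ : ι₁ → Finset κ₁) (m₁ : ι₁ → ℝ) (P₂ : ι₂ → Finset κ₂) (m₂ : ι₂ → ℝ)
    (h₁ : ∀ c₁, ∑ i, m₁ i * (((P₁ i).filter fun a => key₁ a = c₁).card : ℝ) = ((D₁.filter fun a => key₁ a = c₁).card : ℝ))
    (h₂ : ∀ c₂, ∑ j, m₂ j * (((P₂ j).filter fun b => key₂ b = c₂).card : ℝ) = ((D₂.filter fun b => key₂ b = c₂).card : ℝ))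
    (c₁ : γ₁) (c₂ : γ₂) :
    ∑ ij : ι₁ × ι₂, (m₁ ij.1 * m₂ ij.2) *
        ((((P₁ ij.1) ×ˢ (P₂ ij.2)).filter fun ω => (key₁ ω.1, key₂ ω.2) = (c₁, c₂)).card : ℝ) =
      (((D₁ ×ˢ D₂).filter fun ω => (key₁ ω.1, key₂ ω.2) = (c₁, c₂)).card : ℝ) := by
  simp_rw [filter_product_key, Finset.card_product, Nat.cast_mul]
  rw [← h₁ c₁, ← h₂ c₂, Finset.sum_mul_sum, Fintype.sum_prod_type]
  refine Finset.sum_congr rfl fun i _ => Finset.sum_congr rfl fun j _ => ?_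
  ring

end ProductCover
end Antithetic

end Summit.CriticalPhenomena.PercolationContinuityZ3.Theorems
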